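import Summits.QuantumFields.YangMills.Theorems.BalabanUVNodesN11TStepInnerCentralWindowChartAtRegionsOfProvisos
import Summits.QuantumFields.YangMills.Theorems.BalabanUVNodesN11PlaqSmallOfSect3Events
import Summits.QuantumFields.YangMills.Theorems.BalabanUVNodesN11CubeCoverRowOfNesting

/-!
# DAG node N11 — THE SUPPORT CLAUSE OF THE CENTRAL-WINDOW ROAD DISCHARGED TO NUMERICS: FILE 13's kernel-level LEFT side of (O3′) ∕ def-T's (†) at def-R's regions with
# `hwq` PRODUCED by dag-n11-w2 g4's `plaqHol_small_near_of_wOfRecord_ne_zero` (def-T's weights ⇒ (3.2)∧(3.3) ⇒ [B7] Prop. 2 local k-fold (dag-n11-d g12) + FILE 14's telescoping)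
# and the point cover of `Ω_{k+1}(s)` by dag-n11-w4 g3's nesting theorem — displayed: `θ.Provisos₁₃CoPH`, `hslot`, and NUMERICS only; at `k = 0` `hslot` is a theorem too

HEADER — WORK-UNIT METADATA.  Cell `pub-ymgap`, YM-PLAN Track A (HUMAN RULING D-0062), seat `pub-ymgap-dag-n08-w2` (g10; WIDTH SEAT 2∕4 on N08 [B10], RE-POINTED to
N11's [III] §3-supply residue), route `BalabanUVNodes`, key item K1⁷ `StabilityBAtRecordR13SepCoPH` = stmt-QuantumFields-20542 (helper lane, `--kind proof --supports 20542
--as helper` — jail key; K1⁹ stmt-QuantumFields-27364 is the K1-face of record, mis-key rule; count-neutral; (B4)-socket bookkeeping).  [III] = [Balaban1988Convergent],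
[I] = [Balaban1987RG1], [B7] = [Balaban1985Averaging].  FILE 16 of this seat's kernel-level socket = FILE 13 `…AtRegionsOfProvisos` (p636743 ★ `…_atRegions_of_provisos_of_plaqSmall`)
and FILE 12 `…AtRegions` (p634883 ★ `exists_ae_forall_tstepOfRecord_eq_kernelRTOfRecord_atRegions_of_plaqSmall`) composed BY NAME with dag-n11-w2 g4's p641510
`…N11PlaqSmallOfSect3Events` (★★ `plaqHol_small_near_of_wOfRecord_ne_zero`: wherever def-T's `w_k(s′)(U,V′) ≠ 0`, under a POINT COVER of `Ω_{k+1}(s′)` by the χ-cubes inside it and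
[B7] Prop.-2 ∕ cube-size numerics, every level-`k` plaquette based in the three blocks of a coarse bond with an endpoint in `Ω_{k+1}(s′)` is within `4·(2δ_k) + 2ε_{k+1}∕L²` of `1` —
(3.2)∧(3.3) read off the weights (their F10 p638096), (3.3) ⇒ plaquette closeness (this seat's FILE 14 p639516 `dist1_plaqHol_lt_of_smallApproxFluct`), (3.2) ⇒ small plaquettes
of `V^{(k)}_{□′} = M^k(U_{k+1,□′})` by dag-n11-d g12's LOCAL k-FOLD [B7] Prop. 2 `…N11LocalIteratedAveraging` ∕ `…N11ChiTopRegularity`), dag-n11-w4 g3's `…N11CubeCoverRowOfNesting`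
(★ `cover_at_of_dvd_of_nesting`: under `L·M₂ ∣ M` and `dCubeSide … ∣ sitesPerDir 0` a 𝐃-region is covered by the χ-cubes inside it), `B10Eq71TorusOverlap.toFine_eq_embIter`,
def-T's `Node00/Record12ResidualsSlots.measurable_rhoZeroOfRecord` and `chiSeqOfRecord_zero`.  CONSUMED BY NAME, nothing modified.

WHY THIS FILE.  FILES 12∕13 display ONE support clause `hwq` «`w_k(s)(U,V′) ≠ 0 ⇒` small level-`k` plaquettes of `U` at the three blocks of every coarse bond meeting
`Ω_{k+1}(s)`»; FILE 15 reduced it to a BACKGROUND row + a COVERING row.  Both are now THEOREMS of the tree: dag-n11-w2 g4's p641510 §4 IS `hwq` modulo a point cover of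
`Ω_{k+1}(s)` and numerics (its background half by dag-n11-d g12's k-uniform local Prop. 2 — the (3.4) field is an average, no solvability), and the point cover is dag-n11-w4 g3's nesting
theorem.  THIS FILE is the KNIT at the socket: the kernel-level LEFT side of (O3′) at def-R's regions (§2, Stage-13 letters) and def-T's (†) for all new sequences (§4, generic letters at
`w := wOfRecord … A₁ ζ`) hold on the central α-window with the support clause DISCHARGED — displayed are `θ.Provisos₁₃CoPH` (resp. the rows `hw`∕`hwj`∕`hχ`∕`hT`∕`hGi`), the
measurability row `hslot` (K0c), and NUMERICS: the α-guards, `((d+2)L)²∕4·(4·(2δ_k) + 2ε_{k+1}∕L²) ≤ α`, `0 ≤ δ_k`, [B7] Prop.-2 numerics (`hα3`, `hα2`, `0 < ε_{k+1}`), the cube size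
`3L^{k+1} + ((d+4)L+2)·Σ_{l<k}L^l + 2 ≤ sideχ`, and node00-def's nesting `0 < sideD`, `L·M₂ ∣ M`, `sideD ∣ sitesPerDir 0`.  At `k = 0` (§3, §5) `hslot` is def-T's
`measurable_rhoZeroOfRecord` and `hχ` is `χ_0 ≡ 1`: NUMERICS ONLY beside `θ.Provisos₁₃CoPH` (resp. `hw`∕`hwj`∕`hT`∕`hGi`).  (This supersedes the seat's planned collar∕background editions,
announced I.39436 and withdrawn: dag-n11-w2's F12 proved the background half outright.)

WHAT THIS FILE PROVES (0 `def`, 0 `sorry`, standard axioms).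
§1 `exists_mem_cubeχ_of_mem_Omega_succ_of_nesting` (n11-w4's cube cover at the step-(k+1) region of record, POINT form) · `embIter_endpoint_mem_of_not_mem_bondsIn_compl`.
§2 ★★★ `exists_ae_forall_slotsTOfRecord₁₃H_succ_eq_kernelRTOfRecord_atRegions_of_provisos_of_nesting` (all `k`).
§3 ★★★ `exists_ae_forall_slotsTOfRecord₁₃H_one_eq_kernelRTOfRecord_atRegions_of_provisos_of_nesting` (`k = 0`: `hslot` discharged).
§4 ★★ `exists_ae_forall_tstepOfRecord_eq_kernelRTOfRecord_atRegions_of_nesting` (def-T's (†) ∀ `s′`, generic `ν M A₁ ζ`, all `k`).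
§5 ★★ `exists_ae_forall_tstepOfRecord_zero_eq_kernelRTOfRecord_atRegions_of_nesting` (its `k = 0` face: `hχ` discharged).

HONEST FRAMING.  Helper lane of K1⁷ (aside key); count-neutral; by-name composition over dag-n11-w2's, dag-n11-d's and dag-n11-w4's theorems; the numerics (Prop.-2, cube size,
window, nesting — node00-def's admissibility, NOT derived), `hslot` (k ≥ 1) and `θ.Provisos₁₃CoPH` (resp. `hw`∕`hwj`∕`hχ`∕`hT`∕`hGi`) REMAIN HYPOTHESES, displayed; NO chart of Bałaban's
((47), [III] (3.10)–(3.25)) asserted — a valid chart of the disintegration on the central α-window, not print's; nothing of Bałaban ([I] §2, [III] §3, Thm 1–2) asserted; (B4)∕(S-α)∕(O3′)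
NOT closed; N11 NOT discharged; N08 untouched; K1⁷∕K1⁸∕K1⁹ NOT closed, no registered stub touched; counts unmoved (typed 28∕28 · discharged 5∕27 · A 5∕28).  One finite `𝕋⁴_{L^K}`
programme at fixed `ε = L^{−K}`; R4 closes only the conditional finite-𝕋⁴ rung `BalabanLadder.UV` — NOT ℝ⁴, NOT OS, NOT a mass gap, NOT Clay.  No `sorry`, `axiom`, `def`, `instance`,
`notation`.  Sources (SHAPE ∕ bookkeeping only): [III] (2.1) p.254, (2.16)–(2.18) p.257, (2.21) p.258, (3.1) p.264, (3.2)–(3.5) p.265, p.267 L18–24, (3.24)–(3.25) p.270, Thm 1 p.262;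
[I] (0.1) p.251, (0.4) p.253, (2.9) p.266; [B7] Prop. 2 (52)–(54) p.26.
-/

noncomputable section

open MeasureTheory ProbabilityTheory Set Function
open scoped ENNReal NNReal BigOperators

namespace Summit.QuantumFields.YangMills.Theorems.BalabanUVNodesN11TStepInnerCentralWindowChartAtRegionsOfNesting

open Literature.MathematicalPhysics.QuantumFieldTheory.Balaban1983to89
open Literature.MathematicalPhysics.QuantumFieldTheory.Balaban1983to89.T4AveragingDisintegration
open Literature.MathematicalPhysics.QuantumFieldTheory.Balaban1983to89.BlockAveraging (Small Idx avgFun loopHol)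
open Literature.MathematicalPhysics.QuantumFieldTheory.Balaban1983to89.BlockAveragingHaarAC (centralBond pre post centralBond_injective isLocal_avgFun)
open Literature.MathematicalPhysics.QuantumFieldTheory.Balaban1983to89.BlockAveragingEMLHaarAC (fibreFamily offCard)
open Literature.MathematicalPhysics.QuantumFieldTheory.Balaban1983to89.ExpMeanLog (expMeanLogSU deltaSU)
open Literature.MathematicalPhysics.QuantumFieldTheory.Balaban1983to89.B14.Eq218Concrete (cubesIn mem_cubesIn)
open Literature.MathematicalPhysics.QuantumFieldTheory.Balaban1983to89.B15DeterminingSets (embIter)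
open Literature.MathematicalPhysics.QuantumFieldTheory.Balaban1983to89.B10Eq71TorusOverlap (toFine_eq_embIter)
open BalabanUVNodesN11TStepInnerCentralWindowChartAtRegions BalabanUVNodesN11TStepInnerCentralWindowChartAtRegionsOfProvisos
open BalabanUVNodesN11PlaqSmallOfSect3Events (plaqHol_small_near_of_wOfRecord_ne_zero)
open BalabanUVNodesN11CubeCoverRowOfNesting (cover_at_of_dvd_of_nesting)
open BalabanUVNodesN11TransportOfRecordInPrivateCoordinateChart (succ_le_m_add_K)

open Node00 hiding SU
open T4Continuum
open B10Eq42TorusConstraint (bondsIn mem_bondsIn_iff)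
open B10Eq38TorusDomains (toFine)

variable {F : T4Family} {N : ℕ} [NeZero N]

/-! ## §1  The point cover of `Ω_{k+1}(s)` from the nesting numerics; a coarse bond off `bondsIn (k+1) (Ω_{k+1}(s))ᶜ` has an endpoint in `Ω_{k+1}(s)` -/

/-- **dag-n11-w4's CUBE COVER AT THE STEP-(k+1) REGION OF RECORD, POINT FORM**: under `L·M₂ ∣ M` and `sideD ∣ sitesPerDir 0`, every point of `Ω_{k+1}(s)` (a member of
`𝐃_{k+1}`, `s.chain.memΩ`) lies in a χ-cube INSIDE `Ω_{k+1}(s)` — the shape of dag-n11-w2's `hcov`. [cite: Balaban1988Convergent, (2.1) p.254, (2.17) p.257, (3.5) p.265] -/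
theorem exists_mem_cubeχ_of_mem_Omega_succ_of_nesting (ν : Stage7Numerics) {M : ℕ} (p : B12.RunParams) (g : ℕ → ℝ) {k : ℕ} (hdiv : (F.P p.K).L * ν.M₂ ∣ M)
    (hPC : sideD F ν M p g k ∣ (F.P p.K).sitesPerDir 0) (s : SeqOfRecord F ν M g p.K (k + 1)) :
    ∀ y ∈ s.Ω (k + 1), ∃ c ∈ cubesIn (cubeχ F ν p g k) (s.Ω (k + 1)), y ∈ cubeχ F ν p g k c := by
  intro y hy
  have h : s.Ω (k + 1) ⊆ ⋃ c' ∈ cubesIn (cubeχ F ν p g k) (s.Ω (k + 1)), cubeχ F ν p g k c' :=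
    cover_at_of_dvd_of_nesting ν g p.K (k + 1) hdiv hPC (s.chain.memΩ (k + 1) (Nat.succ_pos k) le_rfl)
  obtain ⟨c, hc, hyc⟩ := Set.mem_iUnion₂.1 (h hy)
  exact ⟨c, hc, hyc⟩

/-- A coarse bond NOT lying in `bondsIn (k+1) (Ω_{k+1}(s))ᶜ` has an endpoint whose `ι_{k+1}`-image lies in `Ω_{k+1}(s)` (`toFine = embIter`). [cite: Balaban1985UV3, (42) p.266 (bookkeeping)] -/
theorem embIter_endpoint_mem_of_not_mem_bondsIn_compl {K k : ℕ} {X : Set (Site (F.P K) 0)} {c : PBond (F.P K) (k + 1)} (hc : c ∉ bondsIn (k + 1) Xᶜ) :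
    embIter (k + 1) c.src ∈ X ∨ embIter (k + 1) c.tgt ∈ X := by
  by_cases h1 : embIter (k + 1) c.src ∈ X
  · exact Or.inl h1
  · by_cases h2 : embIter (k + 1) c.tgt ∈ X
    · exact Or.inr h2
    · refine absurd (mem_bondsIn_iff.2 ⟨?_, ?_⟩) hc
      · rw [toFine_eq_embIter]; exact h1
      · rw [toFine_eq_embIter]; exact h2

variable (p : B12.RunParams) {k : ℕ}

/-! ## §2  All `k`: the kernel-level LEFT side of (O3′) at def-R's regions, the support clause DISCHARGED to numerics -/

/-- **★★★ THE KERNEL-LEVEL LEFT SIDE OF (O3′) AT def-R's REGIONS FROM THE CORE PROVISOS — SUPPORT CLAUSE DISCHARGED**: FILE 13 ★ `…_atRegions_of_provisos_of_plaqSmall` at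
`δ := 4·(2δ_k) + 2ε_{k+1}∕L²` with `hwq` PRODUCED by dag-n11-w2's `plaqHol_small_near_of_wOfRecord_ne_zero` (def-T's weights ⇒ (3.2)∧(3.3) at the χ-cubes of `Ω_{k+1}(s)` ⇒ dag-n11-d's
local k-fold [B7] Prop. 2 + FILE 14's telescoping) and its point cover by §1 (dag-n11-w4, `L·M₂ ∣ M`, `sideD ∣ sitesPerDir 0`).  DISPLAYED: `θ.Provisos₁₃CoPH`, `hslot`, and numerics —
the α-guards, `((d+2)L)²∕4·δ ≤ α`, `0 ≤ δ_k`, `0 < ε_{k+1}`, `hα3`, `hα2` ([B7] Prop. 2 at `α₀ = ε_{k+1}∕L²`), the cube size `hR`, `0 < sideD`, `L·M₂ ∣ M`, `sideD ∣ sitesPerDir 0`.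
Conclusion verbatim FILE 13's. [cite: Balaban1988Convergent, (2.1) p.254, (2.16)–(2.18) p.257, (2.21) p.258, (3.1) p.264, (3.2)–(3.5) p.265, p.267 L18–24, (3.24)–(3.25) p.270; Balaban1987RG1, (0.4) p.253, (2.9) p.266; Balaban1985Averaging, Prop. 2 p.26] -/
theorem exists_ae_forall_slotsTOfRecord₁₃H_succ_eq_kernelRTOfRecord_atRegions_of_provisos_of_nesting (θ : Stage13HParams F N) (h : θ.Provisos₁₃CoPH F N)
    (hk : k < p.K) {α : ℝ} (hα0 : 0 ≤ α) (hα : α ≤ 1 / 24) (hαδ : α < deltaSU (Fin N))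
    (hgap : ∀ c : PBond (F.P p.K) (k + 1), (offCard c : ℝ) / (Fintype.card (Idx (F.P p.K)) : ℝ) + 150 * α < 1)
    (hδk : 0 ≤ deltaOfRecord θ.ν (gOfRecord₁₃ F N θ.toStage13Params p) k θ.A₁) (hε : 0 < epsOfRecord θ.ν (gOfRecord₁₃ F N θ.toStage13Params p) (k + 1))
    (hδα : ((((F.P p.K).d + 2) * (F.P p.K).L : ℕ) : ℝ) ^ 2 / 4 * (4 * (2 * deltaOfRecord θ.ν (gOfRecord₁₃ F N θ.toStage13Params p) k θ.A₁) + 2 * (epsOfRecord θ.ν (gOfRecord₁₃ F N θ.toStage13Params p) (k + 1) / ((F.P p.K).L : ℝ) ^ 2)) ≤ α)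
    (hα3 : (143 * (((((F.P p.K).d + 4 : ℕ) : ℝ)) ^ 2 / 4) ^ 2) * (epsOfRecord θ.ν (gOfRecord₁₃ F N θ.toStage13Params p) (k + 1) / ((F.P p.K).L : ℝ) ^ 2) ≤ 1 / 3)
    (hα2 : 2 * (epsOfRecord θ.ν (gOfRecord₁₃ F N θ.toStage13Params p) (k + 1) / ((F.P p.K).L : ℝ) ^ 2) ≤ 2 * deltaSU (Fin N) / ((((F.P p.K).d + 4) * (F.P p.K).L : ℕ) : ℝ) ^ 2)
    (hR : 3 * (F.P p.K).L ^ (k + 1) + (((F.P p.K).d + 4) * (F.P p.K).L + 2) * (∑ l ∈ Finset.range k, (F.P p.K).L ^ l) + 2 ≤ sideχ F θ.ν p (gOfRecord₁₃ F N θ.toStage13Params p) k)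
    (hslot : ∀ s₀ : SeqOfRecord F θ.ν θ.τ9.M (gOfRecord₁₃ F N θ.toStage13Params p) p.K k,
      Measurable (slotsOfRecord F N θ.ν θ.τ9 (EOfRecord₁₃ F N θ.toStage13Params) (wOfRecord₉ F N θ.toStage9Params) θ.ppSel p (gOfRecord₁₃ F N θ.toStage13Params p) k s₀))
    (hD : 0 < sideD F θ.ν θ.τ9.M p (gOfRecord₁₃ F N θ.toStage13Params p) k) (hdiv : (F.P p.K).L * θ.ν.M₂ ∣ θ.τ9.M) (hPC : sideD F θ.ν θ.τ9.M p (gOfRecord₁₃ F N θ.toStage13Params p) k ∣ (F.P p.K).sitesPerDir 0) :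
    ∃ (T : PBond (F.P p.K) (k + 1) → GaugeField (F.P p.K) k (SU N) → Set (SU N))
      (ϑ : PBond (F.P p.K) (k + 1) → GaugeField (F.P p.K) k (SU N) → SU N → SU N)
      (jd : PBond (F.P p.K) (k + 1) → GaugeField (F.P p.K) k (SU N) → SU N → ℝ≥0),
      (∀ c, MeasurableSet {q : GaugeField (F.P p.K) k (SU N) × SU N | q.2 ∈ T c q.1}) ∧
      (∀ c, Measurable fun q : GaugeField (F.P p.K) k (SU N) × SU N => ϑ c q.1 q.2) ∧
      (∀ c, Measurable fun q : GaugeField (F.P p.K) k (SU N) × SU N => jd c q.1 q.2) ∧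
      ∀ᵐ V' ∂(fieldMeasure (F.P p.K) (k + 1) (SU N)), ∀ s : SeqOfRecord F θ.ν θ.τ9.M (gOfRecord₁₃ F N θ.toStage13Params p) p.K (k + 1),
        slotsTOfRecord F N θ.ν θ.τ9 (EOfRecord₁₃ F N θ.toStage13Params) (wOfRecord₉ F N θ.toStage9Params) θ.ppSel p (gOfRecord₁₃ F N θ.toStage13Params p) (k + 1) s V' =
          kernelRTOfRecord F N p.K k (Set.toFinite (bondsIn k (s.Ω (k + 1))ᶜ)).toFinset (Set.toFinite (bondsIn (k + 1) (s.Ω (k + 1))ᶜ)).toFinset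
            (fun y => ∫ uin,
              (({z : ((↥(Set.toFinite (bondsIn k (s.Ω (k + 1))ᶜ)).toFinset → SU N) ×
                    ({c : PBond (F.P p.K) (k + 1) // c ∉ (Set.toFinite (bondsIn (k + 1) (s.Ω (k + 1))ᶜ)).toFinset} → SU N)) ×
                    ({b : PBond (F.P p.K) k // b ∉ (Set.toFinite (bondsIn k (s.Ω (k + 1))ᶜ)).toFinset} → SU N) |
                  ∀ c : {c : PBond (F.P p.K) (k + 1) // c ∉ (Set.toFinite (bondsIn (k + 1) (s.Ω (k + 1))ᶜ)).toFinset},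
                    z.1.2 c ∈ T c ((MeasurableEquiv.piEquivPiSubtypeProd (fun _ : PBond (F.P p.K) k => SU N)
                      (· ∈ (Set.toFinite (bondsIn k (s.Ω (k + 1))ᶜ)).toFinset)).symm (z.1.1, z.2))}.indicator
                (fun z => ∏ c : {c : PBond (F.P p.K) (k + 1) // c ∉ (Set.toFinite (bondsIn (k + 1) (s.Ω (k + 1))ᶜ)).toFinset},
                  jd c ((MeasurableEquiv.piEquivPiSubtypeProd (fun _ : PBond (F.P p.K) k => SU N)
                    (· ∈ (Set.toFinite (bondsIn k (s.Ω (k + 1))ᶜ)).toFinset)).symm (z.1.1, z.2)) (z.1.2 c))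
                ((y, (MeasurableEquiv.piEquivPiSubtypeProd (fun _ : PBond (F.P p.K) (k + 1) => SU N)
                  (· ∈ (Set.toFinite (bondsIn (k + 1) (s.Ω (k + 1))ᶜ)).toFinset) V').2), uin) : ℝ≥0) : ℝ) *
              ((fun U : GaugeField (F.P p.K) k (SU N) =>
                  wOfRecord₉ F N θ.toStage9Params p (gOfRecord₁₃ F N θ.toStage13Params p) k s U V' *
                    (chiSeqOfRecord F N θ.ν θ.τ9.M (gOfRecord₁₃ F N θ.toStage13Params p) p.K k s.init U *
                      slotsOfRecord F N θ.ν θ.τ9 (EOfRecord₁₃ F N θ.toStage13Params) (wOfRecord₉ F N θ.toStage9Params) θ.ppSel p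
                        (gOfRecord₁₃ F N θ.toStage13Params p) k s.init U))
                ((MeasurableEquiv.piEquivPiSubtypeProd (fun _ : PBond (F.P p.K) k => SU N)
                  (· ∈ (Set.toFinite (bondsIn k (s.Ω (k + 1))ᶜ)).toFinset)).symm (y,
                  extend (fun c : {c : PBond (F.P p.K) (k + 1) // c ∉ (Set.toFinite (bondsIn (k + 1) (s.Ω (k + 1))ᶜ)).toFinset} =>
                      (⟨centralBond (c : PBond (F.P p.K) (k + 1)), centralBond_not_mem_bondsInFinset_compl_Omega hk s c c.2⟩ :
                        {b : PBond (F.P p.K) k // b ∉ (Set.toFinite (bondsIn k (s.Ω (k + 1))ᶜ)).toFinset}))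
                    (fun c : {c : PBond (F.P p.K) (k + 1) // c ∉ (Set.toFinite (bondsIn (k + 1) (s.Ω (k + 1))ᶜ)).toFinset} =>
                      ϑ c ((MeasurableEquiv.piEquivPiSubtypeProd (fun _ : PBond (F.P p.K) k => SU N)
                        (· ∈ (Set.toFinite (bondsIn k (s.Ω (k + 1))ᶜ)).toFinset)).symm (y, uin))
                        ((MeasurableEquiv.piEquivPiSubtypeProd (fun _ : PBond (F.P p.K) (k + 1) => SU N)
                          (· ∈ (Set.toFinite (bondsIn (k + 1) (s.Ω (k + 1))ᶜ)).toFinset) V').2 c)) uin)))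
              ∂(Measure.pi fun _ : {b : PBond (F.P p.K) k // b ∉ (Set.toFinite (bondsIn k (s.Ω (k + 1))ᶜ)).toFinset} => (HaarData.haar : Measure (SU N))))
            (MeasurableEquiv.piEquivPiSubtypeProd (fun _ : PBond (F.P p.K) (k + 1) => SU N)
              (· ∈ (Set.toFinite (bondsIn (k + 1) (s.Ω (k + 1))ᶜ)).toFinset) V').1 :=
  exists_ae_forall_slotsTOfRecord₁₃H_succ_eq_kernelRTOfRecord_atRegions_of_provisos_of_plaqSmall p θ h hk hα0 hα hαδ hgap
    (add_nonneg (by positivity) (by positivity)) hδα hslot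
    fun s U V' hne c hc q hq =>
      plaqHol_small_near_of_wOfRecord_ne_zero F N θ.ν θ.τ9.M p (gOfRecord₁₃ F N θ.toStage13Params p) (succ_le_m_add_K hk) θ.A₁ θ.ζ hD hR hε hα3 hα2 s U V' hne
        (exists_mem_cubeχ_of_mem_Omega_succ_of_nesting θ.ν p (gOfRecord₁₃ F N θ.toStage13Params p) hdiv hPC s) c (embIter_endpoint_mem_of_not_mem_bondsIn_compl hc) q hq

/-! ## §3  The first step: `θ.Provisos₁₃CoPH` and numerics ONLY -/

/-- **★★★ THE FIRST STEP's REPRESENTED-TOWER PRE-𝐑 SLOTS AT def-R's REGIONS OF RECORD ON THE CENTRAL α-WINDOW — `θ.Provisos₁₃CoPH` AND NUMERICS ONLY**: §2 at `k = 0` (`0 < K`)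
with `hslot` DISCHARGED by def-T's `measurable_rhoZeroOfRecord` (`slot_0 = ρ₀`); the cube-size numeric reads `3L + 2 ≤ L²M₂R₁` (empty sum). [cite: Balaban1988Convergent, Thm 1 p.262, (2.1) p.254, (2.16)–(2.18) p.257, (2.21) p.258, (3.1) p.264, (3.2)–(3.5) p.265, p.267 L18–24, (3.24)–(3.25) p.270; Balaban1987RG1, (0.4) p.253, (2.9) p.266; Balaban1985Averaging, Prop. 2 p.26] -/
theorem exists_ae_forall_slotsTOfRecord₁₃H_one_eq_kernelRTOfRecord_atRegions_of_provisos_of_nesting (θ : Stage13HParams F N) (h : θ.Provisos₁₃CoPH F N)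
    (hK : 0 < p.K) {α : ℝ} (hα0 : 0 ≤ α) (hα : α ≤ 1 / 24) (hαδ : α < deltaSU (Fin N))
    (hgap : ∀ c : PBond (F.P p.K) 1, (offCard c : ℝ) / (Fintype.card (Idx (F.P p.K)) : ℝ) + 150 * α < 1)
    (hδk : 0 ≤ deltaOfRecord θ.ν (gOfRecord₁₃ F N θ.toStage13Params p) 0 θ.A₁) (hε : 0 < epsOfRecord θ.ν (gOfRecord₁₃ F N θ.toStage13Params p) 1)
    (hδα : ((((F.P p.K).d + 2) * (F.P p.K).L : ℕ) : ℝ) ^ 2 / 4 * (4 * (2 * deltaOfRecord θ.ν (gOfRecord₁₃ F N θ.toStage13Params p) 0 θ.A₁) + 2 * (epsOfRecord θ.ν (gOfRecord₁₃ F N θ.toStage13Params p) 1 / ((F.P p.K).L : ℝ) ^ 2)) ≤ α)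
    (hα3 : (143 * (((((F.P p.K).d + 4 : ℕ) : ℝ)) ^ 2 / 4) ^ 2) * (epsOfRecord θ.ν (gOfRecord₁₃ F N θ.toStage13Params p) 1 / ((F.P p.K).L : ℝ) ^ 2) ≤ 1 / 3)
    (hα2 : 2 * (epsOfRecord θ.ν (gOfRecord₁₃ F N θ.toStage13Params p) 1 / ((F.P p.K).L : ℝ) ^ 2) ≤ 2 * deltaSU (Fin N) / ((((F.P p.K).d + 4) * (F.P p.K).L : ℕ) : ℝ) ^ 2)
    (hR : 3 * (F.P p.K).L + 2 ≤ sideχ F θ.ν p (gOfRecord₁₃ F N θ.toStage13Params p) 0)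
    (hD : 0 < sideD F θ.ν θ.τ9.M p (gOfRecord₁₃ F N θ.toStage13Params p) 0) (hdiv : (F.P p.K).L * θ.ν.M₂ ∣ θ.τ9.M) (hPC : sideD F θ.ν θ.τ9.M p (gOfRecord₁₃ F N θ.toStage13Params p) 0 ∣ (F.P p.K).sitesPerDir 0) :
    ∃ (T : PBond (F.P p.K) 1 → GaugeField (F.P p.K) 0 (SU N) → Set (SU N))
      (ϑ : PBond (F.P p.K) 1 → GaugeField (F.P p.K) 0 (SU N) → SU N → SU N)
      (jd : PBond (F.P p.K) 1 → GaugeField (F.P p.K) 0 (SU N) → SU N → ℝ≥0),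
      (∀ c, MeasurableSet {q : GaugeField (F.P p.K) 0 (SU N) × SU N | q.2 ∈ T c q.1}) ∧
      (∀ c, Measurable fun q : GaugeField (F.P p.K) 0 (SU N) × SU N => ϑ c q.1 q.2) ∧
      (∀ c, Measurable fun q : GaugeField (F.P p.K) 0 (SU N) × SU N => jd c q.1 q.2) ∧
      ∀ᵐ V' ∂(fieldMeasure (F.P p.K) 1 (SU N)), ∀ s : SeqOfRecord F θ.ν θ.τ9.M (gOfRecord₁₃ F N θ.toStage13Params p) p.K 1,
        slotsTOfRecord F N θ.ν θ.τ9 (EOfRecord₁₃ F N θ.toStage13Params) (wOfRecord₉ F N θ.toStage9Params) θ.ppSel p (gOfRecord₁₃ F N θ.toStage13Params p) 1 s V' =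
          kernelRTOfRecord F N p.K 0 (Set.toFinite (bondsIn 0 (s.Ω 1)ᶜ)).toFinset (Set.toFinite (bondsIn 1 (s.Ω 1)ᶜ)).toFinset
            (fun y => ∫ uin,
              (({z : ((↥(Set.toFinite (bondsIn 0 (s.Ω 1)ᶜ)).toFinset → SU N) ×
                    ({c : PBond (F.P p.K) 1 // c ∉ (Set.toFinite (bondsIn 1 (s.Ω 1)ᶜ)).toFinset} → SU N)) ×
                    ({b : PBond (F.P p.K) 0 // b ∉ (Set.toFinite (bondsIn 0 (s.Ω 1)ᶜ)).toFinset} → SU N) |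
                  ∀ c : {c : PBond (F.P p.K) 1 // c ∉ (Set.toFinite (bondsIn 1 (s.Ω 1)ᶜ)).toFinset},
                    z.1.2 c ∈ T c ((MeasurableEquiv.piEquivPiSubtypeProd (fun _ : PBond (F.P p.K) 0 => SU N)
                      (· ∈ (Set.toFinite (bondsIn 0 (s.Ω 1)ᶜ)).toFinset)).symm (z.1.1, z.2))}.indicator
                (fun z => ∏ c : {c : PBond (F.P p.K) 1 // c ∉ (Set.toFinite (bondsIn 1 (s.Ω 1)ᶜ)).toFinset},
                  jd c ((MeasurableEquiv.piEquivPiSubtypeProd (fun _ : PBond (F.P p.K) 0 => SU N)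
                    (· ∈ (Set.toFinite (bondsIn 0 (s.Ω 1)ᶜ)).toFinset)).symm (z.1.1, z.2)) (z.1.2 c))
                ((y, (MeasurableEquiv.piEquivPiSubtypeProd (fun _ : PBond (F.P p.K) 1 => SU N)
                  (· ∈ (Set.toFinite (bondsIn 1 (s.Ω 1)ᶜ)).toFinset) V').2), uin) : ℝ≥0) : ℝ) *
              ((fun U : GaugeField (F.P p.K) 0 (SU N) =>
                  wOfRecord₉ F N θ.toStage9Params p (gOfRecord₁₃ F N θ.toStage13Params p) 0 s U V' *
                    (chiSeqOfRecord F N θ.ν θ.τ9.M (gOfRecord₁₃ F N θ.toStage13Params p) p.K 0 s.init U *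
                      slotsOfRecord F N θ.ν θ.τ9 (EOfRecord₁₃ F N θ.toStage13Params) (wOfRecord₉ F N θ.toStage9Params) θ.ppSel p
                        (gOfRecord₁₃ F N θ.toStage13Params p) 0 s.init U))
                ((MeasurableEquiv.piEquivPiSubtypeProd (fun _ : PBond (F.P p.K) 0 => SU N)
                  (· ∈ (Set.toFinite (bondsIn 0 (s.Ω 1)ᶜ)).toFinset)).symm (y,
                  extend (fun c : {c : PBond (F.P p.K) 1 // c ∉ (Set.toFinite (bondsIn 1 (s.Ω 1)ᶜ)).toFinset} =>
                      (⟨centralBond (c : PBond (F.P p.K) 1), centralBond_not_mem_bondsInFinset_compl_Omega hK s c c.2⟩ :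
                        {b : PBond (F.P p.K) 0 // b ∉ (Set.toFinite (bondsIn 0 (s.Ω 1)ᶜ)).toFinset}))
                    (fun c : {c : PBond (F.P p.K) 1 // c ∉ (Set.toFinite (bondsIn 1 (s.Ω 1)ᶜ)).toFinset} =>
                      ϑ c ((MeasurableEquiv.piEquivPiSubtypeProd (fun _ : PBond (F.P p.K) 0 => SU N)
                        (· ∈ (Set.toFinite (bondsIn 0 (s.Ω 1)ᶜ)).toFinset)).symm (y, uin))
                        ((MeasurableEquiv.piEquivPiSubtypeProd (fun _ : PBond (F.P p.K) 1 => SU N)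
                          (· ∈ (Set.toFinite (bondsIn 1 (s.Ω 1)ᶜ)).toFinset) V').2 c)) uin)))
              ∂(Measure.pi fun _ : {b : PBond (F.P p.K) 0 // b ∉ (Set.toFinite (bondsIn 0 (s.Ω 1)ᶜ)).toFinset} => (HaarData.haar : Measure (SU N))))
            (MeasurableEquiv.piEquivPiSubtypeProd (fun _ : PBond (F.P p.K) 1 => SU N)
              (· ∈ (Set.toFinite (bondsIn 1 (s.Ω 1)ᶜ)).toFinset) V').1 :=
  exists_ae_forall_slotsTOfRecord₁₃H_succ_eq_kernelRTOfRecord_atRegions_of_provisos_of_nesting p θ h hK hα0 hα hαδ hgap hδk hε hδα hα3 hα2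
    (by rw [Finset.range_zero, Finset.sum_empty, mul_zero, add_zero, zero_add, pow_one]; exact hR)
    (fun _ => measurable_rhoZeroOfRecord F N p.K _ _) hD hdiv hPC

/-! ## §4  def-T's (†) for ALL new sequences at def-R's regions, AT `w := wOfRecord … A₁ ζ` — support clause DISCHARGED to numerics -/

/-- **★★ def-T's (†) AT def-R's REGIONS OF RECORD, ALL `s′` AT ONCE, AT THE STEP WEIGHTS OF RECORD — SUPPORT CLAUSE DISCHARGED** (generic letters `ν M A₁ ζ g`, the edition the
per-density (O3′) road consumes): FILE 12 ★ `exists_ae_forall_tstepOfRecord_eq_kernelRTOfRecord_atRegions_of_plaqSmall` at `w := wOfRecord F N ν M A₁ ζ`, `δ := 4·(2δ_k) + 2ε_{k+1}∕L²`,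
with `hwq` PRODUCED as in §2; displayed as in FILE 12 (α-guards, rows `hw`∕`hwj`∕`hχ`∕`hT`, GRAPH integrability `hGi`) plus the numerics and the nesting.
[cite: Balaban1988Convergent, (2.1) p.254, (2.16)–(2.18) p.257, (2.21) p.258, (3.1) p.264, (3.2)–(3.5) p.265, p.267 L18–24; Balaban1987RG1, (0.4) p.253, (2.9) p.266; Balaban1985Averaging, Prop. 2 p.26] -/
theorem exists_ae_forall_tstepOfRecord_eq_kernelRTOfRecord_atRegions_of_nesting
    (ν : Stage7Numerics) (M : ℕ) (A₁ : ℝ) (ζ : ZetaOfRecord F N ν M) (g : ℕ → ℝ) (hk : k < p.K) (T' : SeqOfRecord F ν M g p.K k → Density (F.P p.K) k (SU N))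
    {α : ℝ} (hα0 : 0 ≤ α) (hα : α ≤ 1 / 24) (hαδ : α < deltaSU (Fin N))
    (hgap : ∀ c : PBond (F.P p.K) (k + 1), (offCard c : ℝ) / (Fintype.card (Idx (F.P p.K)) : ℝ) + 150 * α < 1)
    (hδk : 0 ≤ deltaOfRecord ν g k A₁) (hε : 0 < epsOfRecord ν g (k + 1))
    (hδα : ((((F.P p.K).d + 2) * (F.P p.K).L : ℕ) : ℝ) ^ 2 / 4 * (4 * (2 * deltaOfRecord ν g k A₁) + 2 * (epsOfRecord ν g (k + 1) / ((F.P p.K).L : ℝ) ^ 2)) ≤ α)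
    (hα3 : (143 * (((((F.P p.K).d + 4 : ℕ) : ℝ)) ^ 2 / 4) ^ 2) * (epsOfRecord ν g (k + 1) / ((F.P p.K).L : ℝ) ^ 2) ≤ 1 / 3)
    (hα2 : 2 * (epsOfRecord ν g (k + 1) / ((F.P p.K).L : ℝ) ^ 2) ≤ 2 * deltaSU (Fin N) / ((((F.P p.K).d + 4) * (F.P p.K).L : ℕ) : ℝ) ^ 2)
    (hR : 3 * (F.P p.K).L ^ (k + 1) + (((F.P p.K).d + 4) * (F.P p.K).L + 2) * (∑ l ∈ Finset.range k, (F.P p.K).L ^ l) + 2 ≤ sideχ F ν p g k)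
    (hw : ∀ s' V', Measurable fun U => wOfRecord F N ν M A₁ ζ p g k s' U V')
    (hwj : ∀ s', Measurable fun q : GaugeField (F.P p.K) (k + 1) (SU N) × GaugeField (F.P p.K) k (SU N) => wOfRecord F N ν M A₁ ζ p g k s' q.2 q.1)
    (hχ : ∀ s, Measurable (chiSeqOfRecord F N ν M g p.K k s)) (hT : ∀ s, Measurable (T' s))
    (hD : 0 < sideD F ν M p g k) (hdiv : (F.P p.K).L * ν.M₂ ∣ M) (hPC : sideD F ν M p g k ∣ (F.P p.K).sitesPerDir 0)
    (hGi : ∀ s' : SeqOfRecord F ν M g p.K (k + 1),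
      Integrable (fun U => wOfRecord F N ν M A₁ ζ p g k s' U ((avOfRecord F N p.K k).avg U) * (chiSeqOfRecord F N ν M g p.K k s'.init U * T' s'.init U))
        (fieldMeasure (F.P p.K) k (SU N))) :
    ∃ (T : PBond (F.P p.K) (k + 1) → GaugeField (F.P p.K) k (SU N) → Set (SU N))
      (ϑ : PBond (F.P p.K) (k + 1) → GaugeField (F.P p.K) k (SU N) → SU N → SU N)
      (jd : PBond (F.P p.K) (k + 1) → GaugeField (F.P p.K) k (SU N) → SU N → ℝ≥0),
      (∀ c, MeasurableSet {q : GaugeField (F.P p.K) k (SU N) × SU N | q.2 ∈ T c q.1}) ∧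
      (∀ c, Measurable fun q : GaugeField (F.P p.K) k (SU N) × SU N => ϑ c q.1 q.2) ∧
      (∀ c, Measurable fun q : GaugeField (F.P p.K) k (SU N) × SU N => jd c q.1 q.2) ∧
      ∀ᵐ V' ∂(fieldMeasure (F.P p.K) (k + 1) (SU N)), ∀ s' : SeqOfRecord F ν M g p.K (k + 1),
        tstepOfRecord F N ν M (wOfRecord F N ν M A₁ ζ) p g k T' s' V' =
          kernelRTOfRecord F N p.K k (Set.toFinite (bondsIn k (s'.Ω (k + 1))ᶜ)).toFinset (Set.toFinite (bondsIn (k + 1) (s'.Ω (k + 1))ᶜ)).toFinset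
            (fun y => ∫ uin,
              (({z : ((↥(Set.toFinite (bondsIn k (s'.Ω (k + 1))ᶜ)).toFinset → SU N) ×
                    ({c : PBond (F.P p.K) (k + 1) // c ∉ (Set.toFinite (bondsIn (k + 1) (s'.Ω (k + 1))ᶜ)).toFinset} → SU N)) ×
                    ({b : PBond (F.P p.K) k // b ∉ (Set.toFinite (bondsIn k (s'.Ω (k + 1))ᶜ)).toFinset} → SU N) |
                  ∀ c : {c : PBond (F.P p.K) (k + 1) // c ∉ (Set.toFinite (bondsIn (k + 1) (s'.Ω (k + 1))ᶜ)).toFinset},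
                    z.1.2 c ∈ T c ((MeasurableEquiv.piEquivPiSubtypeProd (fun _ : PBond (F.P p.K) k => SU N)
                      (· ∈ (Set.toFinite (bondsIn k (s'.Ω (k + 1))ᶜ)).toFinset)).symm (z.1.1, z.2))}.indicator
                (fun z => ∏ c : {c : PBond (F.P p.K) (k + 1) // c ∉ (Set.toFinite (bondsIn (k + 1) (s'.Ω (k + 1))ᶜ)).toFinset},
                  jd c ((MeasurableEquiv.piEquivPiSubtypeProd (fun _ : PBond (F.P p.K) k => SU N)
                    (· ∈ (Set.toFinite (bondsIn k (s'.Ω (k + 1))ᶜ)).toFinset)).symm (z.1.1, z.2)) (z.1.2 c))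
                ((y, (MeasurableEquiv.piEquivPiSubtypeProd (fun _ : PBond (F.P p.K) (k + 1) => SU N)
                  (· ∈ (Set.toFinite (bondsIn (k + 1) (s'.Ω (k + 1))ᶜ)).toFinset) V').2), uin) : ℝ≥0) : ℝ) *
              ((fun U : GaugeField (F.P p.K) k (SU N) => wOfRecord F N ν M A₁ ζ p g k s' U V' * (chiSeqOfRecord F N ν M g p.K k s'.init U * T' s'.init U))
                ((MeasurableEquiv.piEquivPiSubtypeProd (fun _ : PBond (F.P p.K) k => SU N)
                  (· ∈ (Set.toFinite (bondsIn k (s'.Ω (k + 1))ᶜ)).toFinset)).symm (y,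
                  extend (fun c : {c : PBond (F.P p.K) (k + 1) // c ∉ (Set.toFinite (bondsIn (k + 1) (s'.Ω (k + 1))ᶜ)).toFinset} =>
                      (⟨centralBond (c : PBond (F.P p.K) (k + 1)), centralBond_not_mem_bondsInFinset_compl_Omega hk s' c c.2⟩ :
                        {b : PBond (F.P p.K) k // b ∉ (Set.toFinite (bondsIn k (s'.Ω (k + 1))ᶜ)).toFinset}))
                    (fun c : {c : PBond (F.P p.K) (k + 1) // c ∉ (Set.toFinite (bondsIn (k + 1) (s'.Ω (k + 1))ᶜ)).toFinset} =>
                      ϑ c ((MeasurableEquiv.piEquivPiSubtypeProd (fun _ : PBond (F.P p.K) k => SU N)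
                        (· ∈ (Set.toFinite (bondsIn k (s'.Ω (k + 1))ᶜ)).toFinset)).symm (y, uin))
                        ((MeasurableEquiv.piEquivPiSubtypeProd (fun _ : PBond (F.P p.K) (k + 1) => SU N)
                          (· ∈ (Set.toFinite (bondsIn (k + 1) (s'.Ω (k + 1))ᶜ)).toFinset) V').2 c)) uin)))
              ∂(Measure.pi fun _ : {b : PBond (F.P p.K) k // b ∉ (Set.toFinite (bondsIn k (s'.Ω (k + 1))ᶜ)).toFinset} => (HaarData.haar : Measure (SU N))))
            (MeasurableEquiv.piEquivPiSubtypeProd (fun _ : PBond (F.P p.K) (k + 1) => SU N)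
              (· ∈ (Set.toFinite (bondsIn (k + 1) (s'.Ω (k + 1))ᶜ)).toFinset) V').1 :=
  exists_ae_forall_tstepOfRecord_eq_kernelRTOfRecord_atRegions_of_plaqSmall p ν M (wOfRecord F N ν M A₁ ζ) g hk T' hα0 hα hαδ hgap
    (add_nonneg (by positivity) (by positivity)) hδα hw hwj hχ hT
    (fun s' U V' hne c hc q hq =>
      plaqHol_small_near_of_wOfRecord_ne_zero F N ν M p g (succ_le_m_add_K hk) A₁ ζ hD hR hε hα3 hα2 s' U V' hne
        (exists_mem_cubeχ_of_mem_Omega_succ_of_nesting ν p g hdiv hPC s') c (embIter_endpoint_mem_of_not_mem_bondsIn_compl hc) q hq) hGi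

/-! ## §5  def-T's (†) at the FIRST STEP for all length-1 histories: `hw`∕`hwj`∕`hT`∕`hGi` and numerics only -/

/-- **★★ def-T's (†) AT THE FIRST STEP, AT def-R's REGIONS, ALL LENGTH-1 HISTORIES, AT `w := wOfRecord … A₁ ζ` — SUPPORT CLAUSE DISCHARGED, `χ_0 ≡ 1`** (generic letters):
§4 at `k = 0` with `hχ` DISCHARGED by def-T's `chiSeqOfRecord_zero`; cube size `3L + 2 ≤ L²M₂R₁`. [cite: Balaban1988Convergent, (2.1) p.254, (2.16)–(2.18) p.257, (2.21) p.258, (3.1) p.264, (3.2)–(3.5) p.265, p.267 L18–24; Balaban1987RG1, (0.4) p.253, (2.9) p.266; Balaban1985Averaging, Prop. 2 p.26] -/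
theorem exists_ae_forall_tstepOfRecord_zero_eq_kernelRTOfRecord_atRegions_of_nesting
    (ν : Stage7Numerics) (M : ℕ) (A₁ : ℝ) (ζ : ZetaOfRecord F N ν M) (g : ℕ → ℝ) (hK : 0 < p.K) (T' : SeqOfRecord F ν M g p.K 0 → Density (F.P p.K) 0 (SU N))
    {α : ℝ} (hα0 : 0 ≤ α) (hα : α ≤ 1 / 24) (hαδ : α < deltaSU (Fin N))
    (hgap : ∀ c : PBond (F.P p.K) 1, (offCard c : ℝ) / (Fintype.card (Idx (F.P p.K)) : ℝ) + 150 * α < 1)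
    (hδk : 0 ≤ deltaOfRecord ν g 0 A₁) (hε : 0 < epsOfRecord ν g 1)
    (hδα : ((((F.P p.K).d + 2) * (F.P p.K).L : ℕ) : ℝ) ^ 2 / 4 * (4 * (2 * deltaOfRecord ν g 0 A₁) + 2 * (epsOfRecord ν g 1 / ((F.P p.K).L : ℝ) ^ 2)) ≤ α)
    (hα3 : (143 * (((((F.P p.K).d + 4 : ℕ) : ℝ)) ^ 2 / 4) ^ 2) * (epsOfRecord ν g 1 / ((F.P p.K).L : ℝ) ^ 2) ≤ 1 / 3)
    (hα2 : 2 * (epsOfRecord ν g 1 / ((F.P p.K).L : ℝ) ^ 2) ≤ 2 * deltaSU (Fin N) / ((((F.P p.K).d + 4) * (F.P p.K).L : ℕ) : ℝ) ^ 2)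
    (hR : 3 * (F.P p.K).L + 2 ≤ sideχ F ν p g 0)
    (hw : ∀ s' V', Measurable fun U => wOfRecord F N ν M A₁ ζ p g 0 s' U V')
    (hwj : ∀ s', Measurable fun q : GaugeField (F.P p.K) 1 (SU N) × GaugeField (F.P p.K) 0 (SU N) => wOfRecord F N ν M A₁ ζ p g 0 s' q.2 q.1)
    (hT : ∀ s, Measurable (T' s))
    (hD : 0 < sideD F ν M p g 0) (hdiv : (F.P p.K).L * ν.M₂ ∣ M) (hPC : sideD F ν M p g 0 ∣ (F.P p.K).sitesPerDir 0)
    (hGi : ∀ s' : SeqOfRecord F ν M g p.K 1,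
      Integrable (fun U => wOfRecord F N ν M A₁ ζ p g 0 s' U ((avOfRecord F N p.K 0).avg U) * (chiSeqOfRecord F N ν M g p.K 0 s'.init U * T' s'.init U))
        (fieldMeasure (F.P p.K) 0 (SU N))) :
    ∃ (T : PBond (F.P p.K) 1 → GaugeField (F.P p.K) 0 (SU N) → Set (SU N))
      (ϑ : PBond (F.P p.K) 1 → GaugeField (F.P p.K) 0 (SU N) → SU N → SU N)
      (jd : PBond (F.P p.K) 1 → GaugeField (F.P p.K) 0 (SU N) → SU N → ℝ≥0),
      (∀ c, MeasurableSet {q : GaugeField (F.P p.K) 0 (SU N) × SU N | q.2 ∈ T c q.1}) ∧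
      (∀ c, Measurable fun q : GaugeField (F.P p.K) 0 (SU N) × SU N => ϑ c q.1 q.2) ∧
      (∀ c, Measurable fun q : GaugeField (F.P p.K) 0 (SU N) × SU N => jd c q.1 q.2) ∧
      ∀ᵐ V' ∂(fieldMeasure (F.P p.K) 1 (SU N)), ∀ s' : SeqOfRecord F ν M g p.K 1,
        tstepOfRecord F N ν M (wOfRecord F N ν M A₁ ζ) p g 0 T' s' V' =
          kernelRTOfRecord F N p.K 0 (Set.toFinite (bondsIn 0 (s'.Ω 1)ᶜ)).toFinset (Set.toFinite (bondsIn 1 (s'.Ω 1)ᶜ)).toFinset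
            (fun y => ∫ uin,
              (({z : ((↥(Set.toFinite (bondsIn 0 (s'.Ω 1)ᶜ)).toFinset → SU N) ×
                    ({c : PBond (F.P p.K) 1 // c ∉ (Set.toFinite (bondsIn 1 (s'.Ω 1)ᶜ)).toFinset} → SU N)) ×
                    ({b : PBond (F.P p.K) 0 // b ∉ (Set.toFinite (bondsIn 0 (s'.Ω 1)ᶜ)).toFinset} → SU N) |
                  ∀ c : {c : PBond (F.P p.K) 1 // c ∉ (Set.toFinite (bondsIn 1 (s'.Ω 1)ᶜ)).toFinset},
                    z.1.2 c ∈ T c ((MeasurableEquiv.piEquivPiSubtypeProd (fun _ : PBond (F.P p.K) 0 => SU N)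
                      (· ∈ (Set.toFinite (bondsIn 0 (s'.Ω 1)ᶜ)).toFinset)).symm (z.1.1, z.2))}.indicator
                (fun z => ∏ c : {c : PBond (F.P p.K) 1 // c ∉ (Set.toFinite (bondsIn 1 (s'.Ω 1)ᶜ)).toFinset},
                  jd c ((MeasurableEquiv.piEquivPiSubtypeProd (fun _ : PBond (F.P p.K) 0 => SU N)
                    (· ∈ (Set.toFinite (bondsIn 0 (s'.Ω 1)ᶜ)).toFinset)).symm (z.1.1, z.2)) (z.1.2 c))
                ((y, (MeasurableEquiv.piEquivPiSubtypeProd (fun _ : PBond (F.P p.K) 1 => SU N)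
                  (· ∈ (Set.toFinite (bondsIn 1 (s'.Ω 1)ᶜ)).toFinset) V').2), uin) : ℝ≥0) : ℝ) *
              ((fun U : GaugeField (F.P p.K) 0 (SU N) => wOfRecord F N ν M A₁ ζ p g 0 s' U V' * (chiSeqOfRecord F N ν M g p.K 0 s'.init U * T' s'.init U))
                ((MeasurableEquiv.piEquivPiSubtypeProd (fun _ : PBond (F.P p.K) 0 => SU N)
                  (· ∈ (Set.toFinite (bondsIn 0 (s'.Ω 1)ᶜ)).toFinset)).symm (y,
                  extend (fun c : {c : PBond (F.P p.K) 1 // c ∉ (Set.toFinite (bondsIn 1 (s'.Ω 1)ᶜ)).toFinset} =>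
                      (⟨centralBond (c : PBond (F.P p.K) 1), centralBond_not_mem_bondsInFinset_compl_Omega hK s' c c.2⟩ :
                        {b : PBond (F.P p.K) 0 // b ∉ (Set.toFinite (bondsIn 0 (s'.Ω 1)ᶜ)).toFinset}))
                    (fun c : {c : PBond (F.P p.K) 1 // c ∉ (Set.toFinite (bondsIn 1 (s'.Ω 1)ᶜ)).toFinset} =>
                      ϑ c ((MeasurableEquiv.piEquivPiSubtypeProd (fun _ : PBond (F.P p.K) 0 => SU N)
                        (· ∈ (Set.toFinite (bondsIn 0 (s'.Ω 1)ᶜ)).toFinset)).symm (y, uin))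
                        ((MeasurableEquiv.piEquivPiSubtypeProd (fun _ : PBond (F.P p.K) 1 => SU N)
                          (· ∈ (Set.toFinite (bondsIn 1 (s'.Ω 1)ᶜ)).toFinset) V').2 c)) uin)))
              ∂(Measure.pi fun _ : {b : PBond (F.P p.K) 0 // b ∉ (Set.toFinite (bondsIn 0 (s'.Ω 1)ᶜ)).toFinset} => (HaarData.haar : Measure (SU N))))
            (MeasurableEquiv.piEquivPiSubtypeProd (fun _ : PBond (F.P p.K) 1 => SU N)
              (· ∈ (Set.toFinite (bondsIn 1 (s'.Ω 1)ᶜ)).toFinset) V').1 := by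
  refine exists_ae_forall_tstepOfRecord_eq_kernelRTOfRecord_atRegions_of_nesting p ν M A₁ ζ g hK T' hα0 hα hαδ hgap hδk hε hδα hα3 hα2
    (by rw [Finset.range_zero, Finset.sum_empty, mul_zero, add_zero, zero_add, pow_one]; exact hR) hw hwj (fun s => ?_) hT hD hdiv hPC hGi
  have h1 : chiSeqOfRecord F N ν M g p.K 0 s = fun _ => 1 := funext fun V => chiSeqOfRecord_zero F N ν M g p.K s V
  rw [h1]; exact measurable_const

/-- **★★★ (v1.1) §2 WITH `hslot` DISCHARGED — ALL `k`: `θ.Provisos₁₃CoPH`, (H-U) `LocalBgMeasurable`, K0b's `HasResidualsOfRecord` AND NUMERICS ONLY** (the slots of record are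
measurable along any history by K0c's `Stage12Params.measurable_slotsOfRecord_of_localBg_of_residuals_hist`, read at `E := EOfRecord₁₃`, `g := gOfRecord₁₃`). [cite: Balaban1988Convergent, (2.18) p.257, (2.21) p.258, (3.1) p.264, (3.2)–(3.5) p.265, (3.24)–(3.25) p.270; Balaban1987RG1, (0.4) p.253; Balaban1985Averaging, Prop. 2 p.26] -/
theorem exists_ae_forall_slotsTOfRecord₁₃H_succ_eq_kernelRTOfRecord_atRegions_of_provisos_of_nesting_of_residuals (θ : Stage13HParams F N) (h : θ.Provisos₁₃CoPH F N)
    (hU : LocalBgMeasurable F N θ.ν) (hres : θ.toStage12Params.HasResidualsOfRecord F N) (hk : k < p.K) {α : ℝ} (hα0 : 0 ≤ α) (hα : α ≤ 1 / 24) (hαδ : α < deltaSU (Fin N))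
    (hgap : ∀ c : PBond (F.P p.K) (k + 1), (offCard c : ℝ) / (Fintype.card (Idx (F.P p.K)) : ℝ) + 150 * α < 1) (hδk : 0 ≤ deltaOfRecord θ.ν (gOfRecord₁₃ F N θ.toStage13Params p) k θ.A₁)
    (hε : 0 < epsOfRecord θ.ν (gOfRecord₁₃ F N θ.toStage13Params p) (k + 1)) (hδα : ((((F.P p.K).d + 2) * (F.P p.K).L : ℕ) : ℝ) ^ 2 / 4 * (4 * (2 * deltaOfRecord θ.ν (gOfRecord₁₃ F N θ.toStage13Params p) k θ.A₁) + 2 * (epsOfRecord θ.ν (gOfRecord₁₃ F N θ.toStage13Params p) (k + 1) / ((F.P p.K).L : ℝ) ^ 2)) ≤ α)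
    (hα3 : (143 * (((((F.P p.K).d + 4 : ℕ) : ℝ)) ^ 2 / 4) ^ 2) * (epsOfRecord θ.ν (gOfRecord₁₃ F N θ.toStage13Params p) (k + 1) / ((F.P p.K).L : ℝ) ^ 2) ≤ 1 / 3) (hα2 : 2 * (epsOfRecord θ.ν (gOfRecord₁₃ F N θ.toStage13Params p) (k + 1) / ((F.P p.K).L : ℝ) ^ 2) ≤ 2 * deltaSU (Fin N) / ((((F.P p.K).d + 4) * (F.P p.K).L : ℕ) : ℝ) ^ 2)
    (hR : 3 * (F.P p.K).L ^ (k + 1) + (((F.P p.K).d + 4) * (F.P p.K).L + 2) * (∑ l ∈ Finset.range k, (F.P p.K).L ^ l) + 2 ≤ sideχ F θ.ν p (gOfRecord₁₃ F N θ.toStage13Params p) k)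
    (hD : 0 < sideD F θ.ν θ.τ9.M p (gOfRecord₁₃ F N θ.toStage13Params p) k) (hdiv : (F.P p.K).L * θ.ν.M₂ ∣ θ.τ9.M) (hPC : sideD F θ.ν θ.τ9.M p (gOfRecord₁₃ F N θ.toStage13Params p) k ∣ (F.P p.K).sitesPerDir 0) :
    ∃ (T : PBond (F.P p.K) (k + 1) → GaugeField (F.P p.K) k (SU N) → Set (SU N))
      (ϑ : PBond (F.P p.K) (k + 1) → GaugeField (F.P p.K) k (SU N) → SU N → SU N)
      (jd : PBond (F.P p.K) (k + 1) → GaugeField (F.P p.K) k (SU N) → SU N → ℝ≥0),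
      (∀ c, MeasurableSet {q : GaugeField (F.P p.K) k (SU N) × SU N | q.2 ∈ T c q.1}) ∧
      (∀ c, Measurable fun q : GaugeField (F.P p.K) k (SU N) × SU N => ϑ c q.1 q.2) ∧
      (∀ c, Measurable fun q : GaugeField (F.P p.K) k (SU N) × SU N => jd c q.1 q.2) ∧
      ∀ᵐ V' ∂(fieldMeasure (F.P p.K) (k + 1) (SU N)), ∀ s : SeqOfRecord F θ.ν θ.τ9.M (gOfRecord₁₃ F N θ.toStage13Params p) p.K (k + 1),
        slotsTOfRecord F N θ.ν θ.τ9 (EOfRecord₁₃ F N θ.toStage13Params) (wOfRecord₉ F N θ.toStage9Params) θ.ppSel p (gOfRecord₁₃ F N θ.toStage13Params p) (k + 1) s V' =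
          kernelRTOfRecord F N p.K k (Set.toFinite (bondsIn k (s.Ω (k + 1))ᶜ)).toFinset (Set.toFinite (bondsIn (k + 1) (s.Ω (k + 1))ᶜ)).toFinset
            (fun y => ∫ uin,
              (({z : ((↥(Set.toFinite (bondsIn k (s.Ω (k + 1))ᶜ)).toFinset → SU N) ×
                    ({c : PBond (F.P p.K) (k + 1) // c ∉ (Set.toFinite (bondsIn (k + 1) (s.Ω (k + 1))ᶜ)).toFinset} → SU N)) ×
                    ({b : PBond (F.P p.K) k // b ∉ (Set.toFinite (bondsIn k (s.Ω (k + 1))ᶜ)).toFinset} → SU N) |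
                  ∀ c : {c : PBond (F.P p.K) (k + 1) // c ∉ (Set.toFinite (bondsIn (k + 1) (s.Ω (k + 1))ᶜ)).toFinset},
                    z.1.2 c ∈ T c ((MeasurableEquiv.piEquivPiSubtypeProd (fun _ : PBond (F.P p.K) k => SU N)
                      (· ∈ (Set.toFinite (bondsIn k (s.Ω (k + 1))ᶜ)).toFinset)).symm (z.1.1, z.2))}.indicator
                (fun z => ∏ c : {c : PBond (F.P p.K) (k + 1) // c ∉ (Set.toFinite (bondsIn (k + 1) (s.Ω (k + 1))ᶜ)).toFinset},
                  jd c ((MeasurableEquiv.piEquivPiSubtypeProd (fun _ : PBond (F.P p.K) k => SU N)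
                    (· ∈ (Set.toFinite (bondsIn k (s.Ω (k + 1))ᶜ)).toFinset)).symm (z.1.1, z.2)) (z.1.2 c))
                ((y, (MeasurableEquiv.piEquivPiSubtypeProd (fun _ : PBond (F.P p.K) (k + 1) => SU N)
                  (· ∈ (Set.toFinite (bondsIn (k + 1) (s.Ω (k + 1))ᶜ)).toFinset) V').2), uin) : ℝ≥0) : ℝ) *
              ((fun U : GaugeField (F.P p.K) k (SU N) =>
                  wOfRecord₉ F N θ.toStage9Params p (gOfRecord₁₃ F N θ.toStage13Params p) k s U V' *
                    (chiSeqOfRecord F N θ.ν θ.τ9.M (gOfRecord₁₃ F N θ.toStage13Params p) p.K k s.init U *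
                      slotsOfRecord F N θ.ν θ.τ9 (EOfRecord₁₃ F N θ.toStage13Params) (wOfRecord₉ F N θ.toStage9Params) θ.ppSel p
                        (gOfRecord₁₃ F N θ.toStage13Params p) k s.init U))
                ((MeasurableEquiv.piEquivPiSubtypeProd (fun _ : PBond (F.P p.K) k => SU N)
                  (· ∈ (Set.toFinite (bondsIn k (s.Ω (k + 1))ᶜ)).toFinset)).symm (y,
                  extend (fun c : {c : PBond (F.P p.K) (k + 1) // c ∉ (Set.toFinite (bondsIn (k + 1) (s.Ω (k + 1))ᶜ)).toFinset} =>
                      (⟨centralBond (c : PBond (F.P p.K) (k + 1)), centralBond_not_mem_bondsInFinset_compl_Omega hk s c c.2⟩ :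
                        {b : PBond (F.P p.K) k // b ∉ (Set.toFinite (bondsIn k (s.Ω (k + 1))ᶜ)).toFinset}))
                    (fun c : {c : PBond (F.P p.K) (k + 1) // c ∉ (Set.toFinite (bondsIn (k + 1) (s.Ω (k + 1))ᶜ)).toFinset} =>
                      ϑ c ((MeasurableEquiv.piEquivPiSubtypeProd (fun _ : PBond (F.P p.K) k => SU N)
                        (· ∈ (Set.toFinite (bondsIn k (s.Ω (k + 1))ᶜ)).toFinset)).symm (y, uin))
                        ((MeasurableEquiv.piEquivPiSubtypeProd (fun _ : PBond (F.P p.K) (k + 1) => SU N)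
                          (· ∈ (Set.toFinite (bondsIn (k + 1) (s.Ω (k + 1))ᶜ)).toFinset) V').2 c)) uin)))
              ∂(Measure.pi fun _ : {b : PBond (F.P p.K) k // b ∉ (Set.toFinite (bondsIn k (s.Ω (k + 1))ᶜ)).toFinset} => (HaarData.haar : Measure (SU N))))
            (MeasurableEquiv.piEquivPiSubtypeProd (fun _ : PBond (F.P p.K) (k + 1) => SU N)
              (· ∈ (Set.toFinite (bondsIn (k + 1) (s.Ω (k + 1))ᶜ)).toFinset) V').1 :=
  exists_ae_forall_slotsTOfRecord₁₃H_succ_eq_kernelRTOfRecord_atRegions_of_provisos_of_nesting p θ h hk hα0 hα hαδ hgap hδk hε hδα hα3 hα2 hR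
    (fun s₀ => θ.toStage12Params.measurable_slotsOfRecord_of_localBg_of_residuals_hist hU hres (EOfRecord₁₃ F N θ.toStage13Params) (fun p' => gOfRecord₁₃ F N θ.toStage13Params p') p k hk.le s₀) hD hdiv hPC

end Summit.QuantumFields.YangMills.Theorems.BalabanUVNodesN11TStepInnerCentralWindowChartAtRegionsOfNesting

end
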